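import Literature.AlgebraicGeometry.HodgeTheory.FermatHodgeConjecture
import Literature.AlgebraicGeometry.Motives.SegreEmbedding
import HarnessLib

/-!
# The Hodge conjecture for PRODUCTS of Fermat varieties of prime degree or degree `≤ 20` (Shioda 1979, Thm. 2), on real carriers

Family `hodge`, layer `Literature/AlgebraicGeometry/HodgeTheory`. A KNOWN CASE of the Hodge conjecture, sibling of
`FermatHodgeConjecture` (`hodgeClasses_algebraic_fermat` = Shioda's Thm. 1 for ONE Fermat variety, whose module docstring
records that "the product statements (PJA Thm. 2; Math. Ann. Thm. IV) are NOT stated" there). This file states the product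
statement, on the same real carriers (`IsRationalClass`, `IsOfHodgeType`, `algebraicClasses`) and with products of `ℂ`-schemes
rendered by the cartesian monoidal structure `X ⊗ Y = X ×_ℂ Y` of `Motives.SchemeOver ℂ` (as everywhere in this layer, e.g.
`IsSmoothProjective.tensor_holds`).

Source READ (held, `paper:doi-10-3792-pjaa-55-111`): T. Shioda, *The Hodge conjecture and the Tate conjecture for Fermat
varieties*, Proc. Japan Acad. 55A (1979) 111–114. Page 112, **verbatim**: "Theorem 1. If the condition `(Pⁿₘ)` is satisfied,
then the Hodge Conjecture for the Fermat variety `Xⁿₘ` is true. The condition `(Pⁿₘ)` has been verified for the following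
values of `m` and `n` (at least): 1) `m` prime, all `n` (Parry), 2) `m ≤ 20`, all `n` and 3) `m = 21` and `n ≤ 10`. …
**Theorem 2. Fix `m > 1`. If the condition `(Pⁿₘ)` is satisfied, then the Hodge Conjecture for arbitrary product
`X^{n₁}_m × ⋯ × X^{n_k}_m` is true.**" (p. 114: "The proof of Theorems 2 and 4 also depends on the existence of the isomorphism
(*) preserving algebraic cycles"; detailed account: Math. Ann. 245 (1979) 175–184, cite-only acq-01075). Read with the list of
Thm. 1: for `m` prime or `1 < m ≤ 20` the condition holds for ALL `n`, hence the Hodge conjecture holds for every finite product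
of Fermat varieties of that common degree `m`. (Secondary: G. da Silva, arXiv:2101.04739, Cor. 3.4: "the Hodge conjecture is
true for arbitrary products of Fermat fourfolds … immediate by [S]".)

## What is vendored, and faithfulness

* `hodgeClasses_algebraic_fermatProduct₂` / `…Product₃` / `…Product₄` (named facts, D-0014): for `m` prime or `1 < m ≤ 20` and
  Fermat varieties `Xᵢ = X^{nᵢ}_m` (each `Motives.IsFermatVariety nᵢ m Xᵢ ∧ Motives.IsSmoothProjective nᵢ Xᵢ`, exactly the pair
  used by the sibling), every rational class of Hodge type `(p,p)` on `X₁ ⊗ X₂` (dimension `n₁ + n₂`), on `(X₁ ⊗ X₂) ⊗ X₃`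
  (`n₁ + n₂ + n₃`), on `((X₁ ⊗ X₂) ⊗ X₃) ⊗ X₄`, lies in `algebraicClasses _ p`. These are the instances `k = 2, 3, 4` of Thm. 2
  with ONE common degree `m` (as printed: "Fix `m > 1` … `X^{n₁}_m × ⋯ × X^{n_k}_m`").
  -- TODO(general form): arbitrary finite products (any `k`); a list-indexed monoidal product is not typed here.
* Hodge types on the product refer to its dimension `Σ nᵢ` (`IsSmoothProjective.tensor_holds` gives
  `IsSmoothProjective (n₁ + n₂) (X₁ ⊗ X₂)`); the `∃`-over-Hodge-models convention of `IsOfHodgeType` is the standing one.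
* Degree range `m.Prime ∨ (1 < m ∧ m ≤ 20)` = items 1), 2) of the list under the standing `m > 1`; `m = 21` NOT stated.
* Upper bound: each fact is an instance family of the summit statement (`…_of_hodgeConjectureFor` below), so nothing
  stronger than the Hodge conjecture is claimed.
* Use: the hweil ladder's transfer principle `Summit.….WeilTypeLadder.mem_algebraicClasses_of_targetTransferFamily`
  (target `X'` with the hypothesis `span{rational (p,p)} ≤ algebraicClasses X' p`) is discharged on `X' = (Xʰₘ)^ℓ` by these facts
  (packet `run/shared/lean/b2b/hodge-weil/b2b-hweil-pv3-g39/ORDERING-LEMMA.md` §3).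

## References

* [Shioda1979PJA] T. Shioda, Proc. Japan Acad. 55A (1979) 111–114, §2 Thm. 2 (p. 112) with the list after Thm. 1 (text read).
* [Shioda1979HodgeFermat] T. Shioda, Math. Ann. 245 (1979) 175–184 (detailed account; cite-only, acq-01075).
* [Deligne2000] P. Deligne, The Hodge conjecture (Clay, 2000), §1.
-/

noncomputable section

open CategoryTheory MonoidalCategory

namespace Literature.AlgebraicGeometry.HodgeTheory

section HodgeTheory

/-! ### The named facts (two, three, four factors) -/

/-- **Shioda 1979, Thm. 2 — two factors** (a THEOREM: the algebraicity of the rational `(d,d)`-classes on every finite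
product of Fermat varieties of one degree `m`, PROVED by Shioda whenever his arithmetic condition `(Pⁿₘ)` holds for all `n`,
which he verified for `m` prime and for `m ≤ 20`; Proc. Japan Acad. 55A p. 112, Thm. 2 with the list after Thm. 1, quoted
verbatim in the module docstring). Rendering (`k = 2`): for `m` prime or `1 < m ≤ 20` and smooth projective Fermat varieties
`X₁ = X^{n₁}_m`, `X₂ = X^{n₂}_m`, every rational class of Hodge type `(p,p)` in `H²ᵖ((X₁ ×_ℂ X₂)(ℂ); ℂ)` lies in
`algebraicClasses (X₁ ⊗ X₂) p`.
[cite: Shioda1979PJA, §2 Thm. 2 (p. 112) with the list after Thm. 1]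
[cite: Shioda1979HodgeFermat, products (detailed account of the PJA announcement)] -/
def hodgeClasses_algebraic_fermatProduct₂ : Prop :=
  ∀ ⦃m : ℕ⦄, m.Prime ∨ (1 < m ∧ m ≤ 20) →
    ∀ ⦃n₁ n₂ : ℕ⦄ ⦃X₁ X₂ : Motives.SchemeOver ℂ⦄,
      Motives.IsFermatVariety n₁ m X₁ → Motives.IsSmoothProjective n₁ X₁ →
      Motives.IsFermatVariety n₂ m X₂ → Motives.IsSmoothProjective n₂ X₂ →
        ∀ (p : ℕ) (c : Literature.AlgebraicTopology.SingularHomology.singularCohomology ℂ ℂ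
            (Motives.ComplexPoints (X₁ ⊗ X₂)) (2 * p)),
          IsRationalClass c → IsOfHodgeType (n₁ + n₂) (X₁ ⊗ X₂) (2 * p) p p c → c ∈ algebraicClasses (X₁ ⊗ X₂) p

/-- **Shioda 1979, Thm. 2 — three factors** (the same THEOREM, `k = 3`): for `m` prime or `1 < m ≤ 20` and smooth projective
Fermat varieties `Xᵢ = X^{nᵢ}_m` (`i = 1,2,3`), every rational class of Hodge type `(p,p)` on `(X₁ ⊗ X₂) ⊗ X₃` (dimension
`n₁ + n₂ + n₃`) lies in `algebraicClasses ((X₁ ⊗ X₂) ⊗ X₃) p`.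
[cite: Shioda1979PJA, §2 Thm. 2 (p. 112) with the list after Thm. 1] -/
def hodgeClasses_algebraic_fermatProduct₃ : Prop :=
  ∀ ⦃m : ℕ⦄, m.Prime ∨ (1 < m ∧ m ≤ 20) →
    ∀ ⦃n₁ n₂ n₃ : ℕ⦄ ⦃X₁ X₂ X₃ : Motives.SchemeOver ℂ⦄,
      Motives.IsFermatVariety n₁ m X₁ → Motives.IsSmoothProjective n₁ X₁ →
      Motives.IsFermatVariety n₂ m X₂ → Motives.IsSmoothProjective n₂ X₂ →
      Motives.IsFermatVariety n₃ m X₃ → Motives.IsSmoothProjective n₃ X₃ →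
        ∀ (p : ℕ) (c : Literature.AlgebraicTopology.SingularHomology.singularCohomology ℂ ℂ
            (Motives.ComplexPoints ((X₁ ⊗ X₂) ⊗ X₃)) (2 * p)),
          IsRationalClass c → IsOfHodgeType (n₁ + n₂ + n₃) ((X₁ ⊗ X₂) ⊗ X₃) (2 * p) p p c →
            c ∈ algebraicClasses ((X₁ ⊗ X₂) ⊗ X₃) p

/-- **Shioda 1979, Thm. 2 — four factors** (the same THEOREM, `k = 4`): for `m` prime or `1 < m ≤ 20` and smooth projective
Fermat varieties `Xᵢ = X^{nᵢ}_m` (`i = 1,…,4`), every rational class of Hodge type `(p,p)` on `((X₁ ⊗ X₂) ⊗ X₃) ⊗ X₄`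
(dimension `n₁ + n₂ + n₃ + n₄`) lies in `algebraicClasses (((X₁ ⊗ X₂) ⊗ X₃) ⊗ X₄) p`.
[cite: Shioda1979PJA, §2 Thm. 2 (p. 112) with the list after Thm. 1] -/
def hodgeClasses_algebraic_fermatProduct₄ : Prop :=
  ∀ ⦃m : ℕ⦄, m.Prime ∨ (1 < m ∧ m ≤ 20) →
    ∀ ⦃n₁ n₂ n₃ n₄ : ℕ⦄ ⦃X₁ X₂ X₃ X₄ : Motives.SchemeOver ℂ⦄,
      Motives.IsFermatVariety n₁ m X₁ → Motives.IsSmoothProjective n₁ X₁ →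
      Motives.IsFermatVariety n₂ m X₂ → Motives.IsSmoothProjective n₂ X₂ →
      Motives.IsFermatVariety n₃ m X₃ → Motives.IsSmoothProjective n₃ X₃ →
      Motives.IsFermatVariety n₄ m X₄ → Motives.IsSmoothProjective n₄ X₄ →
        ∀ (p : ℕ) (c : Literature.AlgebraicTopology.SingularHomology.singularCohomology ℂ ℂ
            (Motives.ComplexPoints (((X₁ ⊗ X₂) ⊗ X₃) ⊗ X₄)) (2 * p)),
          IsRationalClass c → IsOfHodgeType (n₁ + n₂ + n₃ + n₄) (((X₁ ⊗ X₂) ⊗ X₃) ⊗ X₄) (2 * p) p p c →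
            c ∈ algebraicClasses (((X₁ ⊗ X₂) ⊗ X₃) ⊗ X₄) p

/-! ### Upper bound: each fact is an instance family of the Hodge conjecture -/

/-- The Hodge conjecture for all smooth projective varieties (spelled with `HodgeConjectureFor`) implies the two-factor
statement: `X₁ ⊗ X₂` is smooth projective of dimension `n₁ + n₂` (`IsSmoothProjective.tensor_holds`). [cite: Deligne2000, §1] -/
theorem hodgeClasses_algebraic_fermatProduct₂_of_hodgeConjectureFor
    (h : ∀ ⦃n : ℕ⦄ ⦃X : Motives.SchemeOver ℂ⦄, Motives.IsSmoothProjective n X → HodgeConjectureFor n X) :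
    hodgeClasses_algebraic_fermatProduct₂ :=
  fun _ _ _ _ _ _ _ hX₁ _ hX₂ p c hc hpp ↦ (h (Motives.IsSmoothProjective.tensor_holds hX₁ hX₂)).2 p c hc hpp

/-- The Hodge conjecture for all smooth projective varieties implies the three-factor statement. [cite: Deligne2000, §1] -/
theorem hodgeClasses_algebraic_fermatProduct₃_of_hodgeConjectureFor
    (h : ∀ ⦃n : ℕ⦄ ⦃X : Motives.SchemeOver ℂ⦄, Motives.IsSmoothProjective n X → HodgeConjectureFor n X) :
    hodgeClasses_algebraic_fermatProduct₃ :=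
  fun _ _ _ _ _ _ _ _ _ hX₁ _ hX₂ _ hX₃ p c hc hpp ↦
    (h ((Motives.IsSmoothProjective.tensor_holds hX₁ hX₂).tensor_holds hX₃)).2 p c hc hpp

/-- The Hodge conjecture for all smooth projective varieties implies the four-factor statement. [cite: Deligne2000, §1] -/
theorem hodgeClasses_algebraic_fermatProduct₄_of_hodgeConjectureFor
    (h : ∀ ⦃n : ℕ⦄ ⦃X : Motives.SchemeOver ℂ⦄, Motives.IsSmoothProjective n X → HodgeConjectureFor n X) :
    hodgeClasses_algebraic_fermatProduct₄ :=
  fun _ _ _ _ _ _ _ _ _ _ _ hX₁ _ hX₂ _ hX₃ _ hX₄ p c hc hpp ↦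
    (h (((Motives.IsSmoothProjective.tensor_holds hX₁ hX₂).tensor_holds hX₃).tensor_holds hX₄)).2 p c hc hpp

/-! ### The form consumed by transfer arguments -/

/-- **Span form, three factors**: under the fact, on `(X₁ ⊗ X₂) ⊗ X₃` the `ℂ`-span of the rational `(p,p)`-classes consists
of algebraic classes — the hypothesis `hXH` of the hweil ladder's target transfer principle for `X' = (X₁ ⊗ X₂) ⊗ X₃`.
[cite: Shioda1979PJA, §2 Thm. 2 (p. 112) with the list after Thm. 1] -/
theorem span_rational_hodge_le_algebraicClasses_fermatProduct₃ (h : hodgeClasses_algebraic_fermatProduct₃)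
    {m n₁ n₂ n₃ : ℕ} {X₁ X₂ X₃ : Motives.SchemeOver ℂ} (hm : m.Prime ∨ (1 < m ∧ m ≤ 20))
    (hF₁ : Motives.IsFermatVariety n₁ m X₁) (hX₁ : Motives.IsSmoothProjective n₁ X₁)
    (hF₂ : Motives.IsFermatVariety n₂ m X₂) (hX₂ : Motives.IsSmoothProjective n₂ X₂)
    (hF₃ : Motives.IsFermatVariety n₃ m X₃) (hX₃ : Motives.IsSmoothProjective n₃ X₃) (p : ℕ) :
    Submodule.span ℂ {x : Literature.AlgebraicTopology.SingularHomology.singularCohomology ℂ ℂ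
        (Motives.ComplexPoints ((X₁ ⊗ X₂) ⊗ X₃)) (2 * p) |
          IsRationalClass x ∧ IsOfHodgeType (n₁ + n₂ + n₃) ((X₁ ⊗ X₂) ⊗ X₃) (2 * p) p p x} ≤
      algebraicClasses ((X₁ ⊗ X₂) ⊗ X₃) p :=
  Submodule.span_le.2 fun y hy ↦ h hm hF₁ hX₁ hF₂ hX₂ hF₃ hX₃ p y hy.1 hy.2

/-- **Span form, two factors** (same, for `X' = X₁ ⊗ X₂`). [cite: Shioda1979PJA, §2 Thm. 2 (p. 112) with the list after Thm. 1] -/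
theorem span_rational_hodge_le_algebraicClasses_fermatProduct₂ (h : hodgeClasses_algebraic_fermatProduct₂)
    {m n₁ n₂ : ℕ} {X₁ X₂ : Motives.SchemeOver ℂ} (hm : m.Prime ∨ (1 < m ∧ m ≤ 20))
    (hF₁ : Motives.IsFermatVariety n₁ m X₁) (hX₁ : Motives.IsSmoothProjective n₁ X₁)
    (hF₂ : Motives.IsFermatVariety n₂ m X₂) (hX₂ : Motives.IsSmoothProjective n₂ X₂) (p : ℕ) :
    Submodule.span ℂ {x : Literature.AlgebraicTopology.SingularHomology.singularCohomology ℂ ℂ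
        (Motives.ComplexPoints (X₁ ⊗ X₂)) (2 * p) |
          IsRationalClass x ∧ IsOfHodgeType (n₁ + n₂) (X₁ ⊗ X₂) (2 * p) p p x} ≤
      algebraicClasses (X₁ ⊗ X₂) p :=
  Submodule.span_le.2 fun y hy ↦ h hm hF₁ hX₁ hF₂ hX₂ p y hy.1 hy.2

/-! ### More factors: five, seven, nine (the `s = |H′|`-fold targets of COROLLARY R3-CYC′; hweil cell, carver-g114's word)

The SAME printed theorem (Shioda 1979 Thm. 2: "arbitrary product `X^{n₁}_m × ⋯ × X^{n_k}_m`"), instances `k = 5, 7, 9`, each with its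
upper-bound lemma (an instance family of the Hodge conjecture) and its span form. Nothing but the number of factors differs from
`…Product₂/₃/₄` above; a list-indexed monoidal product is still not typed (TODO(general form) stands). -/

/-- **Shioda 1979, Thm. 2 — five factors** (the same THEOREM, `k = 5`; opened on the hweil cell lead's word, carver-g114, for the
`s = 5, 7, 9` rows of the ladder's COROLLARY R3-CYC′): for `m` prime or `1 < m ≤ 20` and smooth projective Fermat varieties
`Xᵢ = X^{nᵢ}_m` (`i = 1,…,5`), every rational class of Hodge type `(p,p)` on `(((X₁ ⊗ X₂) ⊗ X₃) ⊗ X₄) ⊗ X₅`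
(dimension `n₁ + n₂ + n₃ + n₄ + n₅`) lies in `algebraicClasses _ p` — a THEOREM (proved by Shioda whenever `(Pⁿₘ)` holds for all `n`, which he
verified for `m` prime and `m ≤ 20`; the printed sentence is quoted verbatim in the module docstring and under `…Product₂`).
[cite: Shioda1979PJA, §2 Thm. 2 (p. 112) with the list after Thm. 1] -/
def hodgeClasses_algebraic_fermatProduct₅ : Prop :=
  ∀ ⦃m : ℕ⦄, m.Prime ∨ (1 < m ∧ m ≤ 20) →
    ∀ ⦃n₁ n₂ n₃ n₄ n₅ : ℕ⦄ ⦃X₁ X₂ X₃ X₄ X₅ : Motives.SchemeOver ℂ⦄,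
      Motives.IsFermatVariety n₁ m X₁ → Motives.IsSmoothProjective n₁ X₁ →
      Motives.IsFermatVariety n₂ m X₂ → Motives.IsSmoothProjective n₂ X₂ →
      Motives.IsFermatVariety n₃ m X₃ → Motives.IsSmoothProjective n₃ X₃ →
      Motives.IsFermatVariety n₄ m X₄ → Motives.IsSmoothProjective n₄ X₄ →
      Motives.IsFermatVariety n₅ m X₅ → Motives.IsSmoothProjective n₅ X₅ →
        ∀ (p : ℕ) (c : Literature.AlgebraicTopology.SingularHomology.singularCohomology ℂ ℂ
            (Motives.ComplexPoints ((((X₁ ⊗ X₂) ⊗ X₃) ⊗ X₄) ⊗ X₅)) (2 * p)),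
          IsRationalClass c → IsOfHodgeType (n₁ + n₂ + n₃ + n₄ + n₅) ((((X₁ ⊗ X₂) ⊗ X₃) ⊗ X₄) ⊗ X₅) (2 * p) p p c →
            c ∈ algebraicClasses ((((X₁ ⊗ X₂) ⊗ X₃) ⊗ X₄) ⊗ X₅) p

/-- The Hodge conjecture for all smooth projective varieties implies the five-factor statement. [cite: Deligne2000, §1] -/
theorem hodgeClasses_algebraic_fermatProduct₅_of_hodgeConjectureFor
    (h : ∀ ⦃n : ℕ⦄ ⦃X : Motives.SchemeOver ℂ⦄, Motives.IsSmoothProjective n X → HodgeConjectureFor n X) :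
    hodgeClasses_algebraic_fermatProduct₅ :=
  fun _ _ _ _ _ _ _ _ _ _ _ _ _ hX₁ _ hX₂ _ hX₃ _ hX₄ _ hX₅ p c hc hpp ↦
    (h ((((Motives.IsSmoothProjective.tensor_holds hX₁ hX₂).tensor_holds hX₃).tensor_holds hX₄).tensor_holds hX₅)).2 p c hc hpp

/-- **Span form, five factors**: under the fact, on `(((X₁ ⊗ X₂) ⊗ X₃) ⊗ X₄) ⊗ X₅` the `ℂ`-span of the rational
`(p,p)`-classes consists of algebraic classes — the hypothesis `hXH` of the hweil ladder's target transfer principle for this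
target. [cite: Shioda1979PJA, §2 Thm. 2 (p. 112) with the list after Thm. 1] -/
theorem span_rational_hodge_le_algebraicClasses_fermatProduct₅ (h : hodgeClasses_algebraic_fermatProduct₅)
    {m n₁ n₂ n₃ n₄ n₅ : ℕ} {X₁ X₂ X₃ X₄ X₅ : Motives.SchemeOver ℂ} (hm : m.Prime ∨ (1 < m ∧ m ≤ 20))
    (hF₁ : Motives.IsFermatVariety n₁ m X₁) (hX₁ : Motives.IsSmoothProjective n₁ X₁)
    (hF₂ : Motives.IsFermatVariety n₂ m X₂) (hX₂ : Motives.IsSmoothProjective n₂ X₂)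
    (hF₃ : Motives.IsFermatVariety n₃ m X₃) (hX₃ : Motives.IsSmoothProjective n₃ X₃)
    (hF₄ : Motives.IsFermatVariety n₄ m X₄) (hX₄ : Motives.IsSmoothProjective n₄ X₄)
    (hF₅ : Motives.IsFermatVariety n₅ m X₅) (hX₅ : Motives.IsSmoothProjective n₅ X₅) (p : ℕ) :
    Submodule.span ℂ {x : Literature.AlgebraicTopology.SingularHomology.singularCohomology ℂ ℂ
        (Motives.ComplexPoints ((((X₁ ⊗ X₂) ⊗ X₃) ⊗ X₄) ⊗ X₅)) (2 * p) |
          IsRationalClass x ∧ IsOfHodgeType (n₁ + n₂ + n₃ + n₄ + n₅) ((((X₁ ⊗ X₂) ⊗ X₃) ⊗ X₄) ⊗ X₅) (2 * p) p p x} ≤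
      algebraicClasses ((((X₁ ⊗ X₂) ⊗ X₃) ⊗ X₄) ⊗ X₅) p :=
  Submodule.span_le.2 fun y hy ↦ h hm hF₁ hX₁ hF₂ hX₂ hF₃ hX₃ hF₄ hX₄ hF₅ hX₅ p y hy.1 hy.2

/-- **Shioda 1979, Thm. 2 — seven factors** (the same THEOREM, `k = 7`; opened on the hweil cell lead's word, carver-g114, for the
`s = 5, 7, 9` rows of the ladder's COROLLARY R3-CYC′): for `m` prime or `1 < m ≤ 20` and smooth projective Fermat varieties
`Xᵢ = X^{nᵢ}_m` (`i = 1,…,7`), every rational class of Hodge type `(p,p)` on `(((((X₁ ⊗ X₂) ⊗ X₃) ⊗ X₄) ⊗ X₅) ⊗ X₆) ⊗ X₇`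
(dimension `n₁ + n₂ + n₃ + n₄ + n₅ + n₆ + n₇`) lies in `algebraicClasses _ p` — a THEOREM (proved by Shioda whenever `(Pⁿₘ)` holds for all `n`, which he
verified for `m` prime and `m ≤ 20`; the printed sentence is quoted verbatim in the module docstring and under `…Product₂`).
[cite: Shioda1979PJA, §2 Thm. 2 (p. 112) with the list after Thm. 1] -/
def hodgeClasses_algebraic_fermatProduct₇ : Prop :=
  ∀ ⦃m : ℕ⦄, m.Prime ∨ (1 < m ∧ m ≤ 20) →
    ∀ ⦃n₁ n₂ n₃ n₄ n₅ n₆ n₇ : ℕ⦄ ⦃X₁ X₂ X₃ X₄ X₅ X₆ X₇ : Motives.SchemeOver ℂ⦄,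
      Motives.IsFermatVariety n₁ m X₁ → Motives.IsSmoothProjective n₁ X₁ →
      Motives.IsFermatVariety n₂ m X₂ → Motives.IsSmoothProjective n₂ X₂ →
      Motives.IsFermatVariety n₃ m X₃ → Motives.IsSmoothProjective n₃ X₃ →
      Motives.IsFermatVariety n₄ m X₄ → Motives.IsSmoothProjective n₄ X₄ →
      Motives.IsFermatVariety n₅ m X₅ → Motives.IsSmoothProjective n₅ X₅ →
      Motives.IsFermatVariety n₆ m X₆ → Motives.IsSmoothProjective n₆ X₆ →
      Motives.IsFermatVariety n₇ m X₇ → Motives.IsSmoothProjective n₇ X₇ →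
        ∀ (p : ℕ) (c : Literature.AlgebraicTopology.SingularHomology.singularCohomology ℂ ℂ
            (Motives.ComplexPoints ((((((X₁ ⊗ X₂) ⊗ X₃) ⊗ X₄) ⊗ X₅) ⊗ X₆) ⊗ X₇)) (2 * p)),
          IsRationalClass c → IsOfHodgeType (n₁ + n₂ + n₃ + n₄ + n₅ + n₆ + n₇) ((((((X₁ ⊗ X₂) ⊗ X₃) ⊗ X₄) ⊗ X₅) ⊗ X₆) ⊗ X₇) (2 * p) p p c →
            c ∈ algebraicClasses ((((((X₁ ⊗ X₂) ⊗ X₃) ⊗ X₄) ⊗ X₅) ⊗ X₆) ⊗ X₇) p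

/-- The Hodge conjecture for all smooth projective varieties implies the seven-factor statement. [cite: Deligne2000, §1] -/
theorem hodgeClasses_algebraic_fermatProduct₇_of_hodgeConjectureFor
    (h : ∀ ⦃n : ℕ⦄ ⦃X : Motives.SchemeOver ℂ⦄, Motives.IsSmoothProjective n X → HodgeConjectureFor n X) :
    hodgeClasses_algebraic_fermatProduct₇ :=
  fun _ _ _ _ _ _ _ _ _ _ _ _ _ _ _ _ _ hX₁ _ hX₂ _ hX₃ _ hX₄ _ hX₅ _ hX₆ _ hX₇ p c hc hpp ↦
    (h ((((((Motives.IsSmoothProjective.tensor_holds hX₁ hX₂).tensor_holds hX₃).tensor_holds hX₄).tensor_holds hX₅).tensor_holds hX₆).tensor_holds hX₇)).2 p c hc hpp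

/-- **Span form, seven factors**: under the fact, on `(((((X₁ ⊗ X₂) ⊗ X₃) ⊗ X₄) ⊗ X₅) ⊗ X₆) ⊗ X₇` the `ℂ`-span of the rational
`(p,p)`-classes consists of algebraic classes — the hypothesis `hXH` of the hweil ladder's target transfer principle for this
target. [cite: Shioda1979PJA, §2 Thm. 2 (p. 112) with the list after Thm. 1] -/
theorem span_rational_hodge_le_algebraicClasses_fermatProduct₇ (h : hodgeClasses_algebraic_fermatProduct₇)
    {m n₁ n₂ n₃ n₄ n₅ n₆ n₇ : ℕ} {X₁ X₂ X₃ X₄ X₅ X₆ X₇ : Motives.SchemeOver ℂ} (hm : m.Prime ∨ (1 < m ∧ m ≤ 20))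
    (hF₁ : Motives.IsFermatVariety n₁ m X₁) (hX₁ : Motives.IsSmoothProjective n₁ X₁)
    (hF₂ : Motives.IsFermatVariety n₂ m X₂) (hX₂ : Motives.IsSmoothProjective n₂ X₂)
    (hF₃ : Motives.IsFermatVariety n₃ m X₃) (hX₃ : Motives.IsSmoothProjective n₃ X₃)
    (hF₄ : Motives.IsFermatVariety n₄ m X₄) (hX₄ : Motives.IsSmoothProjective n₄ X₄)
    (hF₅ : Motives.IsFermatVariety n₅ m X₅) (hX₅ : Motives.IsSmoothProjective n₅ X₅)
    (hF₆ : Motives.IsFermatVariety n₆ m X₆) (hX₆ : Motives.IsSmoothProjective n₆ X₆)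
    (hF₇ : Motives.IsFermatVariety n₇ m X₇) (hX₇ : Motives.IsSmoothProjective n₇ X₇) (p : ℕ) :
    Submodule.span ℂ {x : Literature.AlgebraicTopology.SingularHomology.singularCohomology ℂ ℂ
        (Motives.ComplexPoints ((((((X₁ ⊗ X₂) ⊗ X₃) ⊗ X₄) ⊗ X₅) ⊗ X₆) ⊗ X₇)) (2 * p) |
          IsRationalClass x ∧ IsOfHodgeType (n₁ + n₂ + n₃ + n₄ + n₅ + n₆ + n₇) ((((((X₁ ⊗ X₂) ⊗ X₃) ⊗ X₄) ⊗ X₅) ⊗ X₆) ⊗ X₇) (2 * p) p p x} ≤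
      algebraicClasses ((((((X₁ ⊗ X₂) ⊗ X₃) ⊗ X₄) ⊗ X₅) ⊗ X₆) ⊗ X₇) p :=
  Submodule.span_le.2 fun y hy ↦ h hm hF₁ hX₁ hF₂ hX₂ hF₃ hX₃ hF₄ hX₄ hF₅ hX₅ hF₆ hX₆ hF₇ hX₇ p y hy.1 hy.2

/-- **Shioda 1979, Thm. 2 — nine factors** (the same THEOREM, `k = 9`; opened on the hweil cell lead's word, carver-g114, for the
`s = 5, 7, 9` rows of the ladder's COROLLARY R3-CYC′): for `m` prime or `1 < m ≤ 20` and smooth projective Fermat varieties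
`Xᵢ = X^{nᵢ}_m` (`i = 1,…,9`), every rational class of Hodge type `(p,p)` on `(((((((X₁ ⊗ X₂) ⊗ X₃) ⊗ X₄) ⊗ X₅) ⊗ X₆) ⊗ X₇) ⊗ X₈) ⊗ X₉`
(dimension `n₁ + n₂ + n₃ + n₄ + n₅ + n₆ + n₇ + n₈ + n₉`) lies in `algebraicClasses _ p` — a THEOREM (proved by Shioda whenever `(Pⁿₘ)` holds for all `n`, which he
verified for `m` prime and `m ≤ 20`; the printed sentence is quoted verbatim in the module docstring and under `…Product₂`).
[cite: Shioda1979PJA, §2 Thm. 2 (p. 112) with the list after Thm. 1] -/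
def hodgeClasses_algebraic_fermatProduct₉ : Prop :=
  ∀ ⦃m : ℕ⦄, m.Prime ∨ (1 < m ∧ m ≤ 20) →
    ∀ ⦃n₁ n₂ n₃ n₄ n₅ n₆ n₇ n₈ n₉ : ℕ⦄ ⦃X₁ X₂ X₃ X₄ X₅ X₆ X₇ X₈ X₉ : Motives.SchemeOver ℂ⦄,
      Motives.IsFermatVariety n₁ m X₁ → Motives.IsSmoothProjective n₁ X₁ →
      Motives.IsFermatVariety n₂ m X₂ → Motives.IsSmoothProjective n₂ X₂ →
      Motives.IsFermatVariety n₃ m X₃ → Motives.IsSmoothProjective n₃ X₃ →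
      Motives.IsFermatVariety n₄ m X₄ → Motives.IsSmoothProjective n₄ X₄ →
      Motives.IsFermatVariety n₅ m X₅ → Motives.IsSmoothProjective n₅ X₅ →
      Motives.IsFermatVariety n₆ m X₆ → Motives.IsSmoothProjective n₆ X₆ →
      Motives.IsFermatVariety n₇ m X₇ → Motives.IsSmoothProjective n₇ X₇ →
      Motives.IsFermatVariety n₈ m X₈ → Motives.IsSmoothProjective n₈ X₈ →
      Motives.IsFermatVariety n₉ m X₉ → Motives.IsSmoothProjective n₉ X₉ →
        ∀ (p : ℕ) (c : Literature.AlgebraicTopology.SingularHomology.singularCohomology ℂ ℂ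
            (Motives.ComplexPoints ((((((((X₁ ⊗ X₂) ⊗ X₃) ⊗ X₄) ⊗ X₅) ⊗ X₆) ⊗ X₇) ⊗ X₈) ⊗ X₉)) (2 * p)),
          IsRationalClass c → IsOfHodgeType (n₁ + n₂ + n₃ + n₄ + n₅ + n₆ + n₇ + n₈ + n₉) ((((((((X₁ ⊗ X₂) ⊗ X₃) ⊗ X₄) ⊗ X₅) ⊗ X₆) ⊗ X₇) ⊗ X₈) ⊗ X₉) (2 * p) p p c →
            c ∈ algebraicClasses ((((((((X₁ ⊗ X₂) ⊗ X₃) ⊗ X₄) ⊗ X₅) ⊗ X₆) ⊗ X₇) ⊗ X₈) ⊗ X₉) p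

/-- The Hodge conjecture for all smooth projective varieties implies the nine-factor statement. [cite: Deligne2000, §1] -/
theorem hodgeClasses_algebraic_fermatProduct₉_of_hodgeConjectureFor
    (h : ∀ ⦃n : ℕ⦄ ⦃X : Motives.SchemeOver ℂ⦄, Motives.IsSmoothProjective n X → HodgeConjectureFor n X) :
    hodgeClasses_algebraic_fermatProduct₉ :=
  fun _ _ _ _ _ _ _ _ _ _ _ _ _ _ _ _ _ _ _ _ _ hX₁ _ hX₂ _ hX₃ _ hX₄ _ hX₅ _ hX₆ _ hX₇ _ hX₈ _ hX₉ p c hc hpp ↦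
    (h ((((((((Motives.IsSmoothProjective.tensor_holds hX₁ hX₂).tensor_holds hX₃).tensor_holds hX₄).tensor_holds hX₅).tensor_holds hX₆).tensor_holds hX₇).tensor_holds hX₈).tensor_holds hX₉)).2 p c hc hpp

/-- **Span form, nine factors**: under the fact, on `(((((((X₁ ⊗ X₂) ⊗ X₃) ⊗ X₄) ⊗ X₅) ⊗ X₆) ⊗ X₇) ⊗ X₈) ⊗ X₉` the `ℂ`-span of the rational
`(p,p)`-classes consists of algebraic classes — the hypothesis `hXH` of the hweil ladder's target transfer principle for this
target. [cite: Shioda1979PJA, §2 Thm. 2 (p. 112) with the list after Thm. 1] -/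
theorem span_rational_hodge_le_algebraicClasses_fermatProduct₉ (h : hodgeClasses_algebraic_fermatProduct₉)
    {m n₁ n₂ n₃ n₄ n₅ n₆ n₇ n₈ n₉ : ℕ} {X₁ X₂ X₃ X₄ X₅ X₆ X₇ X₈ X₉ : Motives.SchemeOver ℂ} (hm : m.Prime ∨ (1 < m ∧ m ≤ 20))
    (hF₁ : Motives.IsFermatVariety n₁ m X₁) (hX₁ : Motives.IsSmoothProjective n₁ X₁)
    (hF₂ : Motives.IsFermatVariety n₂ m X₂) (hX₂ : Motives.IsSmoothProjective n₂ X₂)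
    (hF₃ : Motives.IsFermatVariety n₃ m X₃) (hX₃ : Motives.IsSmoothProjective n₃ X₃)
    (hF₄ : Motives.IsFermatVariety n₄ m X₄) (hX₄ : Motives.IsSmoothProjective n₄ X₄)
    (hF₅ : Motives.IsFermatVariety n₅ m X₅) (hX₅ : Motives.IsSmoothProjective n₅ X₅)
    (hF₆ : Motives.IsFermatVariety n₆ m X₆) (hX₆ : Motives.IsSmoothProjective n₆ X₆)
    (hF₇ : Motives.IsFermatVariety n₇ m X₇) (hX₇ : Motives.IsSmoothProjective n₇ X₇)
    (hF₈ : Motives.IsFermatVariety n₈ m X₈) (hX₈ : Motives.IsSmoothProjective n₈ X₈)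
    (hF₉ : Motives.IsFermatVariety n₉ m X₉) (hX₉ : Motives.IsSmoothProjective n₉ X₉) (p : ℕ) :
    Submodule.span ℂ {x : Literature.AlgebraicTopology.SingularHomology.singularCohomology ℂ ℂ
        (Motives.ComplexPoints ((((((((X₁ ⊗ X₂) ⊗ X₃) ⊗ X₄) ⊗ X₅) ⊗ X₆) ⊗ X₇) ⊗ X₈) ⊗ X₉)) (2 * p) |
          IsRationalClass x ∧ IsOfHodgeType (n₁ + n₂ + n₃ + n₄ + n₅ + n₆ + n₇ + n₈ + n₉) ((((((((X₁ ⊗ X₂) ⊗ X₃) ⊗ X₄) ⊗ X₅) ⊗ X₆) ⊗ X₇) ⊗ X₈) ⊗ X₉) (2 * p) p p x} ≤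
      algebraicClasses ((((((((X₁ ⊗ X₂) ⊗ X₃) ⊗ X₄) ⊗ X₅) ⊗ X₆) ⊗ X₇) ⊗ X₈) ⊗ X₉) p :=
  Submodule.span_le.2 fun y hy ↦ h hm hF₁ hX₁ hF₂ hX₂ hF₃ hX₃ hF₄ hX₄ hF₅ hX₅ hF₆ hX₆ hF₇ hX₇ hF₈ hX₈ hF₉ hX₉ p y hy.1 hy.2

end HodgeTheory

end Literature.AlgebraicGeometry.HodgeTheory

end
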